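import Summits.CriticalPhenomena.SAWScalingLimit.Theses.SAWRenewalTightness
import Summits.CriticalPhenomena.SAWScalingLimit.Theorems.AnnularMassDecay.Negative.LoadBearing
import Summits.CriticalPhenomena.SAWScalingLimit.Theorems.AnnularMassDecay.Negative.Structure

/-!
# Line `Sketch-ideator3g2` (card `first-passage-dyadic-coupling`) for the crux `AnnularMassDecay`
# (stmt-CriticalPhenomena-4729) — the lead's owned skeleton and its CIRCULARITY CERTIFICATE

Lead a1, cycle 1.  The planner sketch `Cruxes/AnnularMassDecay/Sketch-ideator3g2.lean` concludes the crux by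
`annularMassDecay_of : FrameExists → CapDecay → SideDecay → AnnularMassDecay` (cap entries = annular bridges that
are also first passages past `q`-depth `t` in a lattice frame `(q, t)` at the start; side entries = the rest).
This file copies the sketch's definitions VERBATIM (`dq`, `xq`, `IsFP`, `IsAnn`, `capMass`, `sideMass`, `IsFrame`,
`FrameExists`, `CapDecay`, `SideDecay`) and proves, sorry-free:

* `frameExists : FrameExists` — the "routine" stub, discharged (integer direction `q` rounding `n (z - u)`, `t = 1`;
  finiteness of the lattice points of the disc via `Negative.discBox`).
* `isFrame_one : IsFrame q u t z r R → IsFrame q u 1 z r R` — every frame may be lowered to cap level `t = 1`,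
  because `IsFrame` constrains `t` only from above (`t ≤ dq q u v` on the target disc).
* `capMass_one_le_four`, `capMass_one_eq_zero_of_far` — at `t = 1` the cap part is the one-step term: `≤ 4 x_c ≤ 4`,
  and `= 0` once `R > r + 1`.
* `annularMassDecay_of_sideDecay : SideDecay → AnnularMassDecay` — so `CapDecay`, `NearDiagonalDoubling`, the pricing
  and the dyadic sibling lemma are all IDLE in the composition;
* `sideDecay_of_annularMassDecay : AnnularMassDecay → SideDecay` (side entries are a sub-family), hence
* `sideDecay_iff_annularMassDecay : SideDecay ↔ AnnularMassDecay`.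

Conclusion for the line: its one research stub with no mechanism (`SideDecay`, "the shared enemy", card §What the line
still needs: "XL … genuinely as hard as the non-record part of the crux … no new lever offered") is not HALF of the
crux — as typed it IS the crux.  See `Lines/Sketch-ideator3g2.dead.md` for why restricting frames to cap level
`t ≍ (R - r)|q|` does not repair this.  Nothing here asserts a Theses statement.
-/

namespace Summit.CriticalPhenomena.SAWScalingLimit.Cruxes.AnnularMassDecay.Ideator3g2Line

open Literature.Probability.RandomPlanarGeometry Literature.Probability.LatticeModels Filter Topology
open scoped BigOperators Classical
open Summit.CriticalPhenomena.SAWScalingLimit.Theses.SAWRenewalTightness (AnnularMassDecay)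
open Summit.CriticalPhenomena.SAWScalingLimit.Theorems.AnnularMassDecay.Negative

noncomputable section

/-! ### The sketch's definitions, verbatim -/

/-- `q`-depth of `v` below `u`: `⟨v - u, q⟩` (verbatim from the sketch). -/
def dq (q u v : Site 2) : ℤ := (v 0 - u 0) * q 0 + (v 1 - u 1) * q 1

/-- transversal coordinate of `v` in the `q`-frame at `u`: `⟨v - u, q^⊥⟩` (verbatim from the sketch). -/
def xq (q u v : Site 2) : ℤ := (v 0 - u 0) * q 1 - (v 1 - u 1) * q 0

/-- `ω` (an `n`-step walk read from `u`) is a FIRST PASSAGE past `q`-depth `t` (verbatim from the sketch). -/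
def IsFP (q u : Site 2) (t : ℤ) (n : ℕ) (ω : ℕ → Site 2) : Prop :=
  1 ≤ n ∧ (∀ i, 0 < i → i < n → 0 < dq q u (u + ω i) ∧ dq q u (u + ω i) < t) ∧
    t ≤ dq q u (u + ω n)

/-- The crux's filter predicate, verbatim. -/
def IsAnn (z : ℂ) (r R : ℝ) (u : Site 2) (n : ℕ) (ω : ℕ → Site 2) : Prop :=
  (∀ i, 0 < i → i < n → r < dist (Site.toComplex (u + ω i)) z ∧
    dist (Site.toComplex (u + ω i)) z < R) ∧ dist (Site.toComplex (u + ω n)) z ≤ r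

/-- cap (record-type) entries (verbatim from the sketch). -/
def capMass (q u : Site 2) (t : ℤ) (z : ℂ) (r R : ℝ) (N : ℕ) : ℝ :=
  ∑ n ∈ Finset.range (N + 1), ∑ _ω ∈ (SAW.Zd.saws 2 n).filter
    (fun ω => IsAnn z r R u n ω ∧ IsFP q u t n ω), SAW.criticalFugacity ^ n

/-- side entries: the rest (verbatim from the sketch). -/
def sideMass (q u : Site 2) (t : ℤ) (z : ℂ) (r R : ℝ) (N : ℕ) : ℝ :=
  ∑ n ∈ Finset.range (N + 1), ∑ _ω ∈ (SAW.Zd.saws 2 n).filter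
    (fun ω => IsAnn z r R u n ω ∧ ¬ IsFP q u t n ω), SAW.criticalFugacity ^ n

/-- Frames (verbatim from the sketch). -/
def IsFrame (q u : Site 2) (t : ℤ) (z : ℂ) (r R : ℝ) : Prop :=
  q ≠ 0 ∧ 1 ≤ t ∧ (∀ v : Site 2, dist (Site.toComplex v) z < R → v ≠ u → 0 < dq q u v) ∧
    ∀ v : Site 2, dist (Site.toComplex v) z ≤ r → t ≤ dq q u v

/-- FRAME EXISTENCE (verbatim from the sketch). -/
def FrameExists : Prop :=
  ∀ (z : ℂ) (r R : ℝ), 1 ≤ r → r < R → ∀ u : Site 2, R ≤ dist (Site.toComplex u) z →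
    ∃ (q : Site 2) (t : ℤ), IsFrame q u t z r R

/-- CAP DECAY (verbatim from the sketch; shown idle below). -/
def CapDecay : Prop :=
  ∃ θ C : ℝ, 0 < θ ∧ ∀ (z : ℂ) (r R : ℝ), 1 ≤ r → r < R → ∀ (u q : Site 2) (t : ℤ),
    R ≤ dist (Site.toComplex u) z → IsFrame q u t z r R → ∀ N : ℕ,
      capMass q u t z r R N ≤ C * (r / R) ^ θ

/-- SIDE DECAY (verbatim from the sketch: "research stub, the shared enemy"). -/
def SideDecay : Prop :=
  ∃ θ C : ℝ, 0 < θ ∧ ∀ (z : ℂ) (r R : ℝ), 1 ≤ r → r < R → ∀ (u q : Site 2) (t : ℤ),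
    R ≤ dist (Site.toComplex u) z → IsFrame q u t z r R → ∀ N : ℕ,
      sideMass q u t z r R N ≤ C * (r / R) ^ θ

/-! ### The crux's sum is `annMass`; the split; side ≤ total -/

/-- The crux's double sum with the predicate spelled `IsAnn` is `Negative.annMass`. -/
theorem annMass_eq (z : ℂ) (r R : ℝ) (u : Site 2) (N : ℕ) :
    annMass z r R u N = ∑ n ∈ Finset.range (N + 1),
      ∑ _ω ∈ (SAW.Zd.saws 2 n).filter (fun ω => IsAnn z r R u n ω), SAW.criticalFugacity ^ n := by
  unfold annMass
  refine Finset.sum_congr rfl fun n _ => Finset.sum_congr ?_ fun _ _ => rfl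
  ext ω
  simp only [Finset.mem_filter, IsAnn]

/-- The crux's double sum splits exactly into cap + side (the sketch's `ann_eq_cap_add_side`). -/
theorem annMass_eq_cap_add_side (q u : Site 2) (t : ℤ) (z : ℂ) (r R : ℝ) (N : ℕ) :
    annMass z r R u N = capMass q u t z r R N + sideMass q u t z r R N := by
  rw [annMass_eq]
  unfold capMass sideMass
  rw [← Finset.sum_add_distrib]
  refine Finset.sum_congr rfl fun n _ => ?_
  rw [← Finset.sum_filter_add_sum_filter_not ((SAW.Zd.saws 2 n).filter (fun ω => IsAnn z r R u n ω))
    (fun ω => IsFP q u t n ω)]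
  congr 1
  · refine Finset.sum_congr ?_ fun _ _ => rfl
    ext ω
    simp only [Finset.mem_filter, and_assoc]
  · refine Finset.sum_congr ?_ fun _ _ => rfl
    ext ω
    simp only [Finset.mem_filter, and_assoc]

/-- `0 ≤ capMass`. -/
theorem capMass_nonneg (q u : Site 2) (t : ℤ) (z : ℂ) (r R : ℝ) (N : ℕ) : 0 ≤ capMass q u t z r R N :=
  Finset.sum_nonneg fun n _ => Finset.sum_nonneg fun _ _ => pow_nonneg criticalFugacity_pos.le n

/-- Side entries are a sub-family of the crux's family: `sideMass ≤ annMass`. -/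
theorem sideMass_le_annMass (q u : Site 2) (t : ℤ) (z : ℂ) (r R : ℝ) (N : ℕ) :
    sideMass q u t z r R N ≤ annMass z r R u N := by
  rw [annMass_eq_cap_add_side q u t z r R N]
  linarith [capMass_nonneg q u t z r R N]

/-- **The crux implies the line's research stub** (trivially: side entries are a sub-family). -/
theorem sideDecay_of_annularMassDecay (h : AnnularMassDecay) : SideDecay := by
  rw [annularMassDecay_iff] at h
  obtain ⟨θ, C, hθ, h⟩ := h
  exact ⟨θ, C, hθ, fun z r R hr hrR u q t hu _ N =>
    (sideMass_le_annMass q u t z r R N).trans (h z r R hr hrR u hu N)⟩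

/-! ### Lowering the cap level to `t = 1` -/

/-- `IsFrame` bounds `t` only from above: any frame can be lowered to cap level `1`. -/
theorem isFrame_one {q u : Site 2} {t : ℤ} {z : ℂ} {r R : ℝ} (h : IsFrame q u t z r R) :
    IsFrame q u 1 z r R :=
  ⟨h.1, le_rfl, h.2.2.1, fun v hv => h.2.1.trans (h.2.2.2 v hv)⟩

/-- At cap level `t = 1` no walk with an interior vertex is a first passage (`0 < dq < 1` is empty in `ℤ`). -/
theorem not_isFP_one {q u : Site 2} {n : ℕ} {ω : ℕ → Site 2} (hn : 2 ≤ n) : ¬ IsFP q u 1 n ω := by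
  rintro ⟨-, hint, -⟩
  have h := hint 1 one_pos (by omega)
  omega

/-- At cap level `t = 1` the cap part is at most the one-step term: `capMass ≤ c₁ · x_c ≤ 4`. -/
theorem capMass_one_le_four (q u : Site 2) (z : ℂ) (r R : ℝ) (N : ℕ) : capMass q u 1 z r R N ≤ 4 := by
  unfold capMass
  have hx : 0 ≤ SAW.criticalFugacity := criticalFugacity_pos.le
  set f : ℕ → ℝ := fun n => ∑ _ω ∈ (SAW.Zd.saws 2 n).filter
    (fun ω => IsAnn z r R u n ω ∧ IsFP q u 1 n ω), SAW.criticalFugacity ^ n with hf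
  have hf0 : ∀ n, n ≠ 1 → f n = 0 := by
    intro n hn
    rw [hf]
    refine Finset.sum_eq_zero fun ω hω => ?_
    exfalso
    obtain ⟨-, -, hfp⟩ := Finset.mem_filter.1 hω
    rcases Nat.lt_or_ge n 2 with h2 | h2
    · have h1 := hfp.1
      omega
    · exact not_isFP_one h2 hfp
  have hfnn : ∀ n, 0 ≤ f n := fun n => by
    rw [hf]; exact Finset.sum_nonneg fun _ _ => pow_nonneg hx n
  have hf1 : f 1 ≤ 4 := by
    rw [hf]
    dsimp only
    rw [Finset.sum_const, nsmul_eq_mul, pow_one]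
    calc _ ≤ ((SAW.Zd.saws 2 1).card : ℝ) * SAW.criticalFugacity :=
          mul_le_mul_of_nonneg_right (by exact_mod_cast Finset.card_filter_le _ _) hx
      _ ≤ (SAW.Zd.saws 2 1).card * 1 :=
          mul_le_mul_of_nonneg_left criticalFugacity_le_one (Nat.cast_nonneg _)
      _ = (SAW.Zd.count 2 1 : ℝ) := by rw [mul_one, SAW.Zd.card_saws]
      _ ≤ 4 := by exact_mod_cast (SAW.Zd.count_one_le 2).trans (by norm_num)
  calc ∑ n ∈ Finset.range (N + 1), f n
      = ∑ n ∈ (Finset.range (N + 1)).filter (· = 1), f n := by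
        refine (Finset.sum_subset (Finset.filter_subset _ _) fun n hn hn' => hf0 n ?_).symm
        intro h1
        exact hn' (Finset.mem_filter.2 ⟨hn, h1⟩)
    _ ≤ ∑ n ∈ ({1} : Finset ℕ), f n := by
        refine Finset.sum_le_sum_of_subset_of_nonneg (fun n hn => ?_) fun n _ _ => hfnn n
        rw [Finset.mem_singleton]
        exact (Finset.mem_filter.1 hn).2
    _ = f 1 := Finset.sum_singleton _ _
    _ ≤ 4 := hf1

/-- At cap level `t = 1`, once `R > r + 1` the cap part vanishes (the one step cannot reach the target). -/
theorem capMass_one_eq_zero_of_far {q u : Site 2} {z : ℂ} {r R : ℝ} (hfar : r + 1 < R)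
    (hu : R ≤ dist (Site.toComplex u) z) (N : ℕ) : capMass q u 1 z r R N = 0 := by
  unfold capMass
  refine Finset.sum_eq_zero fun n _ => Finset.sum_eq_zero fun ω hω => ?_
  exfalso
  obtain ⟨hsaw, ⟨-, hend⟩, hfp⟩ := Finset.mem_filter.1 hω
  rcases Nat.lt_or_ge n 2 with h2 | h2
  · have h1 : n = 1 := by have := hfp.1; omega
    subst h1
    have hstep := dist_first_step hsaw one_pos u
    have := dist_triangle (Site.toComplex u) (Site.toComplex (u + ω 1)) z
    rw [dist_comm] at hstep
    linarith
  · exact not_isFP_one h2 hfp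

/-! ### The composition needs `SideDecay` only -/

/-- **`SideDecay` alone (with frame existence) gives the crux**: lower the frame to `t = 1`, where the cap part is
the one-step term (`≤ 4`, and `= 0` unless `R ≤ r + 1 ≤ 2r`, where `(r/R)^θ ≥ 2^{-θ}`).  `CapDecay`,
`NearDiagonalDoubling`, the pricing and the dyadic sibling lemma of the sketch are idle. -/
theorem annularMassDecay_of_sideDecay' (hF : FrameExists) (hside : SideDecay) : AnnularMassDecay := by
  rw [annularMassDecay_iff]
  obtain ⟨θ, C, hθ, hS⟩ := hside
  refine ⟨θ, max C 0 + 4 * 2 ^ θ, hθ, fun z r R hr hrR u hu N => ?_⟩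
  obtain ⟨q, t, hfr⟩ := hF z r R hr hrR u hu
  have hfr1 : IsFrame q u 1 z r R := isFrame_one hfr
  have hR : 0 < R := by linarith
  have hx0 : 0 ≤ r / R := div_nonneg (by linarith) hR.le
  have hpow : 0 ≤ (r / R) ^ θ := Real.rpow_nonneg hx0 θ
  have h2θ : 0 < (2 : ℝ) ^ θ := Real.rpow_pos_of_pos two_pos θ
  have hsd : sideMass q u 1 z r R N ≤ max C 0 * (r / R) ^ θ :=
    (hS z r R hr hrR u q 1 hu hfr1 N).trans (mul_le_mul_of_nonneg_right (le_max_left _ _) hpow)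
  have hcap : capMass q u 1 z r R N ≤ 4 * 2 ^ θ * (r / R) ^ θ := by
    rcases lt_or_ge (r + 1) R with hfar | hnear
    · rw [capMass_one_eq_zero_of_far hfar hu N]
      positivity
    · -- `R ≤ r + 1 ≤ 2 r`, so `1/2 ≤ r/R` and `2^θ (r/R)^θ ≥ 1`
      have hhalf : (1 / 2 : ℝ) ≤ r / R := by
        rw [div_le_div_iff₀ two_pos hR]
        linarith
      have h1 : 1 ≤ 2 ^ θ * (r / R) ^ θ := by
        have hm : (1 / 2 : ℝ) ^ θ ≤ (r / R) ^ θ := Real.rpow_le_rpow (by norm_num) hhalf hθ.le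
        have he : (2 : ℝ) ^ θ * (1 / 2) ^ θ = 1 := by
          rw [← Real.mul_rpow two_pos.le (by norm_num)]
          norm_num
        calc (1 : ℝ) = 2 ^ θ * (1 / 2) ^ θ := he.symm
          _ ≤ 2 ^ θ * (r / R) ^ θ := mul_le_mul_of_nonneg_left hm h2θ.le
      calc capMass q u 1 z r R N ≤ 4 := capMass_one_le_four q u z r R N
        _ = 4 * 1 := (mul_one _).symm
        _ ≤ 4 * (2 ^ θ * (r / R) ^ θ) := mul_le_mul_of_nonneg_left h1 (by norm_num)
        _ = 4 * 2 ^ θ * (r / R) ^ θ := by ring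
  rw [annMass_eq_cap_add_side q u 1 z r R N, add_mul]
  linarith

/-! ### Frame existence (the sketch's "routine" stub, discharged) -/

/-- Key inequality: if `|v - z| < R ≤ |u - z|` then `⟨v - u, z - u⟩ > 0` (real inner product). -/
theorem inner_pos {z : ℂ} {R : ℝ} {u v : Site 2} (hu : R ≤ dist (Site.toComplex u) z)
    (hv : dist (Site.toComplex v) z < R) :
    0 < ((v 0 : ℝ) - u 0) * (z.re - u 0) + ((v 1 : ℝ) - u 1) * (z.im - u 1) := by
  have h : dist (Site.toComplex v) z < dist (Site.toComplex u) z := hv.trans_le hu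
  have h2 := mul_self_lt_mul_self dist_nonneg h
  rw [dist_eq_norm, dist_eq_norm, ← pow_two, ← pow_two, Complex.sq_norm, Complex.sq_norm,
    Complex.normSq_apply, Complex.normSq_apply] at h2
  simp only [Complex.sub_re, Complex.sub_im, Site.toComplex_re, Site.toComplex_im] at h2
  nlinarith [sq_nonneg ((v 0 : ℝ) - u 0), sq_nonneg ((v 1 : ℝ) - u 1), h2]

/-- Rounding: `a ⌊x⌋ ≥ a x - |a|`. -/
theorem mul_floor_ge (a x : ℝ) : a * x - |a| ≤ a * ⌊x⌋ := by
  have h1 : (⌊x⌋ : ℝ) ≤ x := Int.floor_le x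
  have h2 : x < ⌊x⌋ + 1 := Int.lt_floor_add_one x
  have h3 : |a * ((⌊x⌋ : ℝ) - x)| ≤ |a| * 1 := by
    rw [abs_mul]
    exact mul_le_mul_of_nonneg_left (abs_le.2 ⟨by linarith, by linarith⟩) (abs_nonneg a)
  have h4 := (abs_le.1 h3).1
  nlinarith [h4]

/-- The rounded directions `q_n = (⌊n (z - u).re⌋, ⌊n (z - u).im⌋)`. -/
def qdir (z : ℂ) (u : Site 2) (n : ℕ) : Site 2 :=
  ![⌊(n : ℝ) * (z.re - u 0)⌋, ⌊(n : ℝ) * (z.im - u 1)⌋]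

/-- `dq` of the rounded direction, as a real number. -/
theorem dq_qdir_cast (z : ℂ) (u v : Site 2) (n : ℕ) :
    ((dq (qdir z u n) u v : ℤ) : ℝ) = ((v 0 : ℝ) - u 0) * ⌊(n : ℝ) * (z.re - u 0)⌋ +
      ((v 1 : ℝ) - u 1) * ⌊(n : ℝ) * (z.im - u 1)⌋ := by
  unfold dq qdir
  push_cast
  simp

/-- For a fixed lattice point `v` of the open disc, `dq (q_n) u v > 0` for all large `n`. -/
theorem eventually_dq_pos {z : ℂ} {R : ℝ} {u v : Site 2} (hu : R ≤ dist (Site.toComplex u) z)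
    (hv : dist (Site.toComplex v) z < R) : ∀ᶠ n : ℕ in atTop, 0 < dq (qdir z u n) u v := by
  set δ : ℝ := ((v 0 : ℝ) - u 0) * (z.re - u 0) + ((v 1 : ℝ) - u 1) * (z.im - u 1) with hδ
  have hδpos : 0 < δ := inner_pos hu hv
  set K : ℝ := |(v 0 : ℝ) - u 0| + |(v 1 : ℝ) - u 1| with hK
  have hlow : ∀ n : ℕ, (n : ℝ) * δ - K ≤ ((dq (qdir z u n) u v : ℤ) : ℝ) := by
    intro n
    rw [dq_qdir_cast]
    have ha := mul_floor_ge ((v 0 : ℝ) - u 0) ((n : ℝ) * (z.re - u 0))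
    have hb := mul_floor_ge ((v 1 : ℝ) - u 1) ((n : ℝ) * (z.im - u 1))
    rw [hδ, hK]
    nlinarith [ha, hb]
  have htend : Tendsto (fun n : ℕ => (n : ℝ) * δ - K) atTop atTop := by
    have h1 : Tendsto (fun n : ℕ => (n : ℝ) * δ) atTop atTop :=
      tendsto_natCast_atTop_atTop.atTop_mul_const hδpos
    simpa [sub_eq_add_neg] using tendsto_atTop_add_const_right atTop (-K) h1
  have htend' : Tendsto (fun n : ℕ => ((dq (qdir z u n) u v : ℤ) : ℝ)) atTop atTop :=
    tendsto_atTop_mono hlow htend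
  filter_upwards [htend'.eventually_gt_atTop 0] with n hn
  exact_mod_cast hn

/-- A direction `q ≠ 0` making every lattice point of the open disc `|· - z| < R` (other than `u`) have positive
`q`-depth below `u`, whenever `|u - z| ≥ R > 1`. -/
theorem exists_direction {z : ℂ} {R : ℝ} {u : Site 2} (hR : 1 < R) (hu : R ≤ dist (Site.toComplex u) z) :
    ∃ q : Site 2, q ≠ 0 ∧ ∀ v : Site 2, dist (Site.toComplex v) z < R → 0 < dq q u v := by
  -- positivity on the finite box containing the disc, for all large `n`
  have hall : ∀ᶠ n : ℕ in atTop, ∀ v ∈ discBox z R, dist (Site.toComplex v) z < R → 0 < dq (qdir z u n) u v := by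
    rw [Filter.eventually_all_finset]
    intro v _
    by_cases hv : dist (Site.toComplex v) z < R
    · filter_upwards [eventually_dq_pos hu hv] with n hn _ using hn
    · exact Filter.Eventually.of_forall fun n h => absurd h hv
  obtain ⟨n, hn⟩ := hall.exists
  have hpos : ∀ v : Site 2, dist (Site.toComplex v) z < R → 0 < dq (qdir z u n) u v :=
    fun v hv => hn v (mem_discBox hv) hv
  refine ⟨qdir z u n, ?_, hpos⟩
  -- `q ≠ 0`: the lattice point nearest to `z` lies in the disc (`R > 1`) and has positive depth
  intro hq
  set v : Site 2 := ![round z.re, round z.im] with hv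
  have hvd : dist (Site.toComplex v) z < R := by
    rw [dist_eq_norm]
    refine lt_of_le_of_lt (Complex.norm_le_abs_re_add_abs_im _) ?_
    have h0 : |(Site.toComplex v - z).re| ≤ 1 / 2 := by
      simp only [Complex.sub_re, Site.toComplex_re, hv, Matrix.cons_val_zero]
      rw [abs_sub_comm]
      exact abs_sub_round z.re
    have h1 : |(Site.toComplex v - z).im| ≤ 1 / 2 := by
      simp only [Complex.sub_im, Site.toComplex_im, hv, Matrix.cons_val_one]
      rw [abs_sub_comm]
      exact abs_sub_round z.im
    linarith
  have h := hpos v hvd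
  rw [hq] at h
  simp [dq] at h

/-- **Frame existence** (the sketch's `FrameExists`, proved): take the direction of `exists_direction` and `t = 1`. -/
theorem frameExists : FrameExists := by
  intro z r R hr hrR u hu
  have hR : 1 < R := by linarith
  obtain ⟨q, hq, hpos⟩ := exists_direction hR hu
  refine ⟨q, 1, hq, le_rfl, fun v hv _ => hpos v hv, fun v hv => ?_⟩
  have h := hpos v (by linarith)
  omega

/-! ### Conclusion: the line's research stub is the crux -/

/-- `SideDecay → AnnularMassDecay`, unconditionally. -/
theorem annularMassDecay_of_sideDecay (hside : SideDecay) : AnnularMassDecay :=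
  annularMassDecay_of_sideDecay' frameExists hside

/-- **Circularity certificate.** The line's research stub `SideDecay` is EQUIVALENT to the crux. -/
theorem sideDecay_iff_annularMassDecay : SideDecay ↔ AnnularMassDecay :=
  ⟨annularMassDecay_of_sideDecay, sideDecay_of_annularMassDecay⟩

/-- The sketch's composition, for the record: with `FrameExists` proved and `CapDecay` idle it reads
`SideDecay → AnnularMassDecay`. -/
theorem annularMassDecay_of (_hF : FrameExists) (_hcap : CapDecay) (hside : SideDecay) : AnnularMassDecay :=
  annularMassDecay_of_sideDecay hside

end

end Summit.CriticalPhenomena.SAWScalingLimit.Cruxes.AnnularMassDecay.Ideator3g2Line
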